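import Summits.ValiantsHypothesis.ValiantsHypothesis.Theses.ProjectionStability
import Summits.ValiantsHypothesis.ValiantsHypothesis.Theorems.ProjectionRigidityProjOptimalUniqueRefutation
import Literature.Computability.AlgebraicComplexity.GrenetEquivariant
import Literature.Computability.AlgebraicComplexity.GrenetProjection
import Literature.Computability.AlgebraicComplexity.DetReprEquivalent
import Literature.Computability.AlgebraicComplexity.LRPencilOfMatrix
import Mathlib.LinearAlgebra.Matrix.Transvection
import Mathlib.LinearAlgebra.Matrix.SchurComplement

/-!
# Line `Sketch`, phase 2 (VACUOUS TRUTH) — skeleton for crux `ProjectionStability.UniqStep`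
# (stmt-ValiantsHypothesis-17834): the antecedent `Uniq n` is FALSE at every level `n ≥ 3`

Crux (by name): `UniqStep = ∀ n ≥ 3, Opt n → Uniq n → Opt (n+1) → Uniq (n+1)`.  Phase 1 of the line
(equivariance split) landed S1–S6 and the symmetry reduction (`uniqStep_iff_symStep`); its bet S7 is
the crux itself.  Phase 2 proves the crux OUTRIGHT, vacuously: under `Opt n` the optimal size is
`m = 2ⁿ − 1`, and at that size there are TWO inequivalent honest projections of `per_n` — Grenet's
matrix and the PURIFIED SOURCE TWIST `K_n` — so `Uniq n` fails and the implication holds.  At `n = 3`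
this is the tree's `not_ProjOptimalUniqueThree` (purified Koszul twist of Grenet₃, cdisprove seat of
stmt-16002); for `n = k + 3 ≥ 3` uniformly:

* `F := 1 − Grenet.adj ℂ n` (the full `2ⁿ × 2ⁿ` matrix on the subsets of `Fin n`, arcs `S → insert j S`
  carry `−X (j, |S|)`, diagonal `1`); Grenet's matrix is `± its (univ, ∅)-minor`.
* SOURCE TWIST (a column Koszul twist at the source, `det` unchanged) followed by the PURIFYING constant
  gauge found in this session (computations `compute/purify_*.py`, verified honest with `det = per`
  for `n = 3, …, 7`; it is `n`-uniform because it only touches the rows `∅, {l}` and the columns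
  `{l}, {1,2}` using the rows/columns `{0,1}, {0,2}, {1,2}`):
  `K_full := P · F · EQ` with
  `P  := diag(−1 at ∅) · T(∅,{0,1},−1) · T({1},∅,−1) · T({1},{0,2},1) · T({0},{1,2},1) · (1 + Σ_{l ≥ 2} E_{{l},{0,1}})`
  `EQ := T({0},{1,2},−X(1,0)) · T({1},{1,2},X(0,0)) · T({0},{1,2},−1) · T({0,2},{1},−1) · diag(−1 at singletons)`
  (`T(i,j,c) = Matrix.transvection i j c`; left factors act on rows, right factors on columns).
  Every cell of `K_full` off the row `univ` and the column `∅` is `−X v` or a constant (V3a, V3b);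
  `adj(K_full)_{∅,univ} = (−1)^k · per_n` (V4: adjugate is anti-multiplicative, `P` fixes the column
  `univ`, `EQ` fixes the row `∅`, `adj(F)_{∅,univ} = per_n` is Grenet's path count in the tree);
  hence the `ε`-signed `(univ, ∅)`-minor `K_n` (same indexing as `Grenet.repr`) is an HONEST `m × m`
  projection with `det K_n = (−1)^k per_n` and the coefficient matrix of `X(0,0)` in `K_n` is
  `E_{i₁ j₁} + E_{i₂ j₁} + E_{i₁ j₂}` (V5), of rank `2` (V6); a row swap fixes the sign for odd `k`.
* INEQUIVALENCE: the coefficient-rank profile is an invariant of `B = P'·A(γx)·Q'`, `B = P'·A(γx)ᵀ·Q'`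
  (`γ ∈ permSymmetrySubst` is a monomial substitution; V6, adapted from the disprover's
  `Cruxes/UniqStep/Disproof.lean` toolkit), and NO coefficient matrix of Grenet's matrix has rank `2`
  when `n ≥ 4` (V7: they are partial permutation matrices with `C(n−1, c)` ones, `= 1` or `≥ 3`).

REGISTERED STUBS (the only `sorry`s): V1 `stub_elementaryOps`, V3a `stub_cells_special`,
V3b `stub_cells_other`, V4 `stub_adjugate`, V5 `stub_minor`, V6 `stub_rankToolkit`, V7 `stub_grenetRank`.
The composition `UniqStep_of` below is PROVED from them (level 3 from `not_ProjOptimalUniqueThree`).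
-/

set_option linter.unusedVariables false
set_option linter.dupNamespace false

namespace Summit.ValiantsHypothesis.ValiantsHypothesis.Cruxes.UniqStep.Vacuous

open MvPolynomial
open scoped BigOperators Matrix
open Literature.Computability.AlgebraicComplexity
open Literature.Computability.AlgebraicComplexity.LRPencil

noncomputable section

/-! ## Registered stubs -/

/-- **V1 — the purifying elementary operations.** Row action and determinant of `P`, column action
and determinant of `EQ` (products of transvections and sign diagonals; `Matrix.transvection_mul_apply_*`,
`Matrix.mul_transvection_apply_*`, `det_transvection_of_ne`, `det_one_add_replicateCol_mul_replicateRow`). -/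
theorem stub_elementaryOps :
    ∀ k : ℕ,
    (∀ (M : Matrix (Finset (Fin (k + 3))) (Finset (Fin (k + 3))) (MvPolynomial (Fin (k + 3) × Fin (k + 3)) ℂ))
        (S T : Finset (Fin (k + 3))),
      (Matrix.diagonal (fun S : Finset (Fin (k + 3)) =>
            if S = ∅ then (-1 : MvPolynomial (Fin (k + 3) × Fin (k + 3)) ℂ) else 1) *
          Matrix.transvection (∅ : Finset (Fin (k + 3))) {0, 1} (-1) *
          Matrix.transvection ({1} : Finset (Fin (k + 3))) ∅ (-1) *
          Matrix.transvection ({1} : Finset (Fin (k + 3))) {0, 2} 1 *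
          Matrix.transvection ({0} : Finset (Fin (k + 3))) {1, 2} 1 *
          (1 + ∑ l ∈ Finset.filter (fun l : Fin (k + 3) => 2 ≤ l.val) Finset.univ,
            Matrix.single ({l} : Finset (Fin (k + 3))) ({0, 1} : Finset (Fin (k + 3)))
              (1 : MvPolynomial (Fin (k + 3) × Fin (k + 3)) ℂ)) * M : Matrix (Finset (Fin (k + 3))) (Finset (Fin (k + 3))) (MvPolynomial (Fin (k + 3) × Fin (k + 3)) ℂ)) S T =
        if S = ∅ then -M ∅ T + M {0, 1} T
        else if S = {0} then M {0} T + M {1, 2} T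
        else if S = {1} then -M ∅ T + M {1} T + M {0, 2} T
        else if S.card = 1 then M S T + M {0, 1} T
        else M S T) ∧
    (Matrix.diagonal (fun S : Finset (Fin (k + 3)) =>
            if S = ∅ then (-1 : MvPolynomial (Fin (k + 3) × Fin (k + 3)) ℂ) else 1) *
          Matrix.transvection (∅ : Finset (Fin (k + 3))) {0, 1} (-1) *
          Matrix.transvection ({1} : Finset (Fin (k + 3))) ∅ (-1) *
          Matrix.transvection ({1} : Finset (Fin (k + 3))) {0, 2} 1 *
          Matrix.transvection ({0} : Finset (Fin (k + 3))) {1, 2} 1 *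
          (1 + ∑ l ∈ Finset.filter (fun l : Fin (k + 3) => 2 ≤ l.val) Finset.univ,
            Matrix.single ({l} : Finset (Fin (k + 3))) ({0, 1} : Finset (Fin (k + 3)))
              (1 : MvPolynomial (Fin (k + 3) × Fin (k + 3)) ℂ))).det = -1 ∧
    (∀ (M : Matrix (Finset (Fin (k + 3))) (Finset (Fin (k + 3))) (MvPolynomial (Fin (k + 3) × Fin (k + 3)) ℂ))
        (S T : Finset (Fin (k + 3))),
      (M * (Matrix.transvection ({0} : Finset (Fin (k + 3))) {1, 2} (-(X (1, 0))) *
          Matrix.transvection ({1} : Finset (Fin (k + 3))) {1, 2} (X (0, 0)) *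
          Matrix.transvection ({0} : Finset (Fin (k + 3))) {1, 2} (-1) *
          Matrix.transvection ({0, 2} : Finset (Fin (k + 3))) {1} (-1) *
          Matrix.diagonal (fun T : Finset (Fin (k + 3)) =>
            if T.card = 1 then (-1 : MvPolynomial (Fin (k + 3) × Fin (k + 3)) ℂ) else 1)) : Matrix (Finset (Fin (k + 3))) (Finset (Fin (k + 3))) (MvPolynomial (Fin (k + 3) × Fin (k + 3)) ℂ)) S T =
        if T = {1, 2} then M S {1, 2} - X (1, 0) * M S {0} + X (0, 0) * M S {1} - M S {0}
        else if T = {1} then -M S {1} + M S {0, 2}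
        else if T.card = 1 then -M S T
        else M S T) ∧
    (Matrix.transvection ({0} : Finset (Fin (k + 3))) {1, 2} (-(X (1, 0))) *
          Matrix.transvection ({1} : Finset (Fin (k + 3))) {1, 2} (X (0, 0)) *
          Matrix.transvection ({0} : Finset (Fin (k + 3))) {1, 2} (-1) *
          Matrix.transvection ({0, 2} : Finset (Fin (k + 3))) {1} (-1) *
          Matrix.diagonal (fun T : Finset (Fin (k + 3)) =>
            if T.card = 1 then (-1 : MvPolynomial (Fin (k + 3) × Fin (k + 3)) ℂ) else 1)).det =
      (-1) ^ (k + 3) := by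
  sorry

/-- **V3a — cells of the purified twist, special rows `∅, {0}, {1}`.** For ANY `P`, `EQ` with the row
and column actions of V1, the cells of `P · (1 − adj) · EQ` in the rows `∅`, `{0}`, `{1}` and the columns
`T ≠ ∅` are `−X v` or constants, and the coefficient of `X(0,0)` is `−1` exactly at `(∅,{0})`, `({1},{0})`,
`(∅,{1,2})`. (Table: row `∅`: `−X(l,0)` at `{l}`, `1` at `{0,1}`, `−X(0,0)` at `{1,2}`, `−X(l,2)` at
`{0,1,l}`; row `{0}`: `−1` at `{0}`, `−X(2,1)` at `{1}`, `−X(l,1)` at `{0,l}`, `−X(1,0)` at `{1,2}`,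
`−X(0,2)` at `{0,1,2}`, `−X(l,2)` at `{1,2,l}`; row `{1}`: `−X(l,0)` at `{l}` (all `l`), `−X(0,1)` at
`{0,1}`, `1` at `{0,2}`, `−X(l,1)` at `{1,l}`, `−X(1,2)` at `{0,1,2}`, `−X(l,2)` at `{0,2,l}`; all other
cells `0`.) -/
theorem stub_cells_special :
    ∀ (k : ℕ) (P EQ : Matrix (Finset (Fin (k + 3))) (Finset (Fin (k + 3))) (MvPolynomial (Fin (k + 3) × Fin (k + 3)) ℂ)),
    (∀ (M : Matrix (Finset (Fin (k + 3))) (Finset (Fin (k + 3))) (MvPolynomial (Fin (k + 3) × Fin (k + 3)) ℂ))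
        (S T : Finset (Fin (k + 3))),
      (P * M) S T =
        if S = ∅ then -M ∅ T + M {0, 1} T
        else if S = {0} then M {0} T + M {1, 2} T
        else if S = {1} then -M ∅ T + M {1} T + M {0, 2} T
        else if S.card = 1 then M S T + M {0, 1} T
        else M S T) →
    (∀ (M : Matrix (Finset (Fin (k + 3))) (Finset (Fin (k + 3))) (MvPolynomial (Fin (k + 3) × Fin (k + 3)) ℂ))
        (S T : Finset (Fin (k + 3))),
      (M * EQ) S T =
        if T = {1, 2} then M S {1, 2} - X (1, 0) * M S {0} + X (0, 0) * M S {1} - M S {0}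
        else if T = {1} then -M S {1} + M S {0, 2}
        else if T.card = 1 then -M S T
        else M S T) →
    ∀ S T : Finset (Fin (k + 3)), (S = ∅ ∨ S = {0} ∨ S = {1}) → T ≠ ∅ →
      ((∃ v, (P * (1 - Grenet.adj ℂ (k + 3)) * EQ) S T = -X v) ∨
        ∃ c, (P * (1 - Grenet.adj ℂ (k + 3)) * EQ) S T = C c) ∧
      MvPolynomial.coeff (Finsupp.single ((0 : Fin (k + 3)), (0 : Fin (k + 3))) 1)
          ((P * (1 - Grenet.adj ℂ (k + 3)) * EQ) S T) =
        if (S = ∅ ∧ T = {0}) ∨ (S = {1} ∧ T = {0}) ∨ (S = ∅ ∧ T = {1, 2}) then -1 else 0 := by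
  sorry

/-- **V3b — cells of the purified twist, all other rows** (`S ≠ univ, ∅, {0}, {1}`): for a singleton
`S = {l}`, `l ≥ 2`: `−1` at `{l}`, `1` at `{0,1}`, `−X(l',1)` at `{l,l'}`, `−X(l',2)` at `{0,1,l'}`, and for
`l = 2` also `−X(0,1)` at `{1}`; for `S = {0,2}`: Grenet's row plus `1` at `{1}`; every other row is
Grenet's row `[S = T] − [T = insert j S] X(j,|S|)`. No cell of these rows contains `X(0,0)`. -/
theorem stub_cells_other :
    ∀ (k : ℕ) (P EQ : Matrix (Finset (Fin (k + 3))) (Finset (Fin (k + 3))) (MvPolynomial (Fin (k + 3) × Fin (k + 3)) ℂ)),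
    (∀ (M : Matrix (Finset (Fin (k + 3))) (Finset (Fin (k + 3))) (MvPolynomial (Fin (k + 3) × Fin (k + 3)) ℂ))
        (S T : Finset (Fin (k + 3))),
      (P * M) S T =
        if S = ∅ then -M ∅ T + M {0, 1} T
        else if S = {0} then M {0} T + M {1, 2} T
        else if S = {1} then -M ∅ T + M {1} T + M {0, 2} T
        else if S.card = 1 then M S T + M {0, 1} T
        else M S T) →
    (∀ (M : Matrix (Finset (Fin (k + 3))) (Finset (Fin (k + 3))) (MvPolynomial (Fin (k + 3) × Fin (k + 3)) ℂ))
        (S T : Finset (Fin (k + 3))),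
      (M * EQ) S T =
        if T = {1, 2} then M S {1, 2} - X (1, 0) * M S {0} + X (0, 0) * M S {1} - M S {0}
        else if T = {1} then -M S {1} + M S {0, 2}
        else if T.card = 1 then -M S T
        else M S T) →
    ∀ S T : Finset (Fin (k + 3)), S ≠ Finset.univ → S ≠ ∅ → S ≠ {0} → S ≠ {1} → T ≠ ∅ →
      ((∃ v, (P * (1 - Grenet.adj ℂ (k + 3)) * EQ) S T = -X v) ∨
        ∃ c, (P * (1 - Grenet.adj ℂ (k + 3)) * EQ) S T = C c) ∧
      MvPolynomial.coeff (Finsupp.single ((0 : Fin (k + 3)), (0 : Fin (k + 3))) 1)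
          ((P * (1 - Grenet.adj ℂ (k + 3)) * EQ) S T) = 0 := by
  sorry

/-- **V4 — the adjugate entry.** For `P`, `EQ` with the actions and determinants of V1 (so that `P`
fixes the column `univ` and `EQ` fixes the row `∅`: apply the actions to `M = 1`),
`adj(P · (1 − adj) · EQ)_{∅, univ} = det EQ · adj(1 − adj)_{∅,univ} · det P = (−1)^k · per_n`
(`Matrix.adjugate_mul_distrib`, `Matrix.mul_adjugate`, `Matrix.adjugate_mul`,
`Grenet.adjugate_one_sub_empty_univ` + `Grenet.sum_ite_injective`). -/
theorem stub_adjugate :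
    ∀ (k : ℕ) (P EQ : Matrix (Finset (Fin (k + 3))) (Finset (Fin (k + 3))) (MvPolynomial (Fin (k + 3) × Fin (k + 3)) ℂ)),
    (∀ (M : Matrix (Finset (Fin (k + 3))) (Finset (Fin (k + 3))) (MvPolynomial (Fin (k + 3) × Fin (k + 3)) ℂ))
        (S T : Finset (Fin (k + 3))),
      (P * M) S T =
        if S = ∅ then -M ∅ T + M {0, 1} T
        else if S = {0} then M {0} T + M {1, 2} T
        else if S = {1} then -M ∅ T + M {1} T + M {0, 2} T
        else if S.card = 1 then M S T + M {0, 1} T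
        else M S T) →
    P.det = -1 →
    (∀ (M : Matrix (Finset (Fin (k + 3))) (Finset (Fin (k + 3))) (MvPolynomial (Fin (k + 3) × Fin (k + 3)) ℂ))
        (S T : Finset (Fin (k + 3))),
      (M * EQ) S T =
        if T = {1, 2} then M S {1, 2} - X (1, 0) * M S {0} + X (0, 0) * M S {1} - M S {0}
        else if T = {1} then -M S {1} + M S {0, 2}
        else if T.card = 1 then -M S T
        else M S T) →
    EQ.det = (-1) ^ (k + 3) →
    (P * (1 - Grenet.adj ℂ (k + 3)) * EQ).adjugate ∅ Finset.univ =
      (-1) ^ k * perPoly (Fin (k + 3)) ℂ := by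
  sorry

/-- **V5 — the signed minor.** If `Kf` has honest-up-to-sign cells off the row `univ` / column `∅`, the
stated `X(0,0)`-coefficients, and `adj(Kf)_{∅,univ} = (−1)^k · per_n`, then its `ε`-signed
`(univ, ∅)`-minor (Grenet's indexing, `e ∅ = 0`, `e univ = last`, `m + 1 = 2^(k+3)`) is an honest
`m × m` matrix with `det = (−1)^k · per_n` whose coefficient matrix of `X(0,0)` is
`E_{i₁j₁} + E_{i₂j₁} + E_{i₁j₂}` with `i₁ ≠ i₂`, `j₁ ≠ j₂` (pattern of `Grenet.isAffineDetRepr_repr`: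
`Matrix.adjugate_submatrix_equiv_self`, `Matrix.adjugate_fin_succ_eq_det_submatrix`, `m` odd; labels
`rowSet_ne_univ`, `exists_rowSet_eq`, … of `GeneralisedGrenetMatrix.lean`). -/
theorem stub_minor :
    ∀ (k m : ℕ), m + 1 = 2 ^ (k + 3) →
    ∀ (e : Finset (Fin (k + 3)) ≃ Fin (m + 1)), e ∅ = 0 → e Finset.univ = Fin.last m →
    ∀ (Kf : Matrix (Finset (Fin (k + 3))) (Finset (Fin (k + 3))) (MvPolynomial (Fin (k + 3) × Fin (k + 3)) ℂ)),
    (∀ S T : Finset (Fin (k + 3)), S ≠ Finset.univ → T ≠ ∅ →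
      ((∃ v, Kf S T = -X v) ∨ ∃ c, Kf S T = C c) ∧
      MvPolynomial.coeff (Finsupp.single ((0 : Fin (k + 3)), (0 : Fin (k + 3))) 1) (Kf S T) =
        if (S = ∅ ∧ T = {0}) ∨ (S = {1} ∧ T = {0}) ∨ (S = ∅ ∧ T = {1, 2}) then -1 else 0) →
    Kf.adjugate ∅ Finset.univ = (-1) ^ k * perPoly (Fin (k + 3)) ℂ →
    (∀ i j, (∃ v, ((-1 : MvPolynomial (Fin (k + 3) × Fin (k + 3)) ℂ) ^ ((e Finset.univ : ℕ) + (e ∅ : ℕ)) •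
        ((Kf.submatrix e.symm e.symm).submatrix (Fin.succAbove (e Finset.univ)) (Fin.succAbove (e ∅)))) i j = X v) ∨
      ∃ c, ((-1 : MvPolynomial (Fin (k + 3) × Fin (k + 3)) ℂ) ^ ((e Finset.univ : ℕ) + (e ∅ : ℕ)) •
        ((Kf.submatrix e.symm e.symm).submatrix (Fin.succAbove (e Finset.univ)) (Fin.succAbove (e ∅)))) i j = C c) ∧
    ((-1 : MvPolynomial (Fin (k + 3) × Fin (k + 3)) ℂ) ^ ((e Finset.univ : ℕ) + (e ∅ : ℕ)) •
        ((Kf.submatrix e.symm e.symm).submatrix (Fin.succAbove (e Finset.univ)) (Fin.succAbove (e ∅)))).det =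
      (-1) ^ k * perPoly (Fin (k + 3)) ℂ ∧
    ∃ (i₁ i₂ j₁ j₂ : Fin m), i₁ ≠ i₂ ∧ j₁ ≠ j₂ ∧
      coeffMat ((-1 : MvPolynomial (Fin (k + 3) × Fin (k + 3)) ℂ) ^ ((e Finset.univ : ℕ) + (e ∅ : ℕ)) •
        ((Kf.submatrix e.symm e.symm).submatrix (Fin.succAbove (e Finset.univ)) (Fin.succAbove (e ∅)))) (0, 0) =
        Matrix.single i₁ j₁ 1 + Matrix.single i₂ j₁ 1 + Matrix.single i₁ j₂ 1 := by
  sorry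

/-- **V6 — rank toolkit.** (a) The coefficient-rank profile is an invariant of the crux's gauge
relation (`γ ∈ permSymmetrySubst` is a monomial substitution; adapted from the disprover's
`Cruxes/UniqStep/Disproof.lean` §(f), any `(n, m)`); (b) `rank (E_{ac} + E_{bc} + E_{ad}) = 2` for
`a ≠ b`, `c ≠ d`; (c) row permutations do not change coefficient ranks. -/
theorem stub_rankToolkit :
    (∀ (n m : ℕ) (A B : Matrix (Fin m) (Fin m) (MvPolynomial (Fin n × Fin n) ℂ))
        (P Q : GL (Fin m) ℂ) (γ : GL (Fin n × Fin n) ℂ), γ ∈ permSymmetrySubst ℂ n →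
      (∀ i j, (∃ v, A i j = X v) ∨ ∃ c, A i j = C c) →
      (B = (P : Matrix _ _ ℂ).map C * Matrix.linSubstEntries γ A * (Q : Matrix _ _ ℂ).map C ∨
        B = (P : Matrix _ _ ℂ).map C * (Matrix.linSubstEntries γ A)ᵀ * (Q : Matrix _ _ ℂ).map C) →
      ∃ w : Fin n × Fin n → Fin n × Fin n, Function.Injective w ∧
        ∀ v, (coeffMat B v).rank = (coeffMat A (w v)).rank) ∧
    (∀ (m : ℕ) (a b c d : Fin m), a ≠ b → c ≠ d →
      (Matrix.single a c (1 : ℂ) + Matrix.single b c 1 + Matrix.single a d 1).rank = 2) ∧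
    (∀ (n m : ℕ) (B : Matrix (Fin m) (Fin m) (MvPolynomial (Fin n × Fin n) ℂ)) (σ : Equiv.Perm (Fin m)) (v : Fin n × Fin n),
      (coeffMat (B.submatrix σ id) v).rank = (coeffMat B v).rank) := by
  sorry

/-- **V7 — no coefficient matrix of Grenet's matrix has rank two** (`n = k + 3 ≥ 4`): the coefficient
matrix of `X(p, q)` in `Grenet.repr ℂ n e` is `±` a partial permutation matrix with `C(n−1, q)` ones
(the arcs `S → insert p S`, `|S| = q`, `p ∉ S`): one cell for `q ∈ {0, n−1}` (rank `≤ 1`,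
`Matrix.rank_vecMulVec_le`), at least `n − 1 ≥ 3` cells in distinct rows and columns otherwise (rank
`≥ 3`, `Matrix.rank_submatrix_le` with an invertible `3 × 3` submatrix). -/
theorem stub_grenetRank :
    ∀ (k m : ℕ), 1 ≤ k → m + 1 = 2 ^ (k + 3) →
    ∀ (e : Finset (Fin (k + 3)) ≃ Fin (m + 1)) (v : Fin (k + 3) × Fin (k + 3)),
      (coeffMat (Grenet.repr ℂ (k + 3) e) v).rank ≠ 2 := by
  sorry

/-! ## Composition -/

/-- Two inequivalent honest `m × m` projections of `per_{k+3}`, `k ≥ 1`, `m + 1 = 2^(k+3)`: Grenet's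
matrix and the purified source twist. Hence the uniqueness clause at `(k+3, m)` is false. -/
theorem not_uniqAt (k m : ℕ) (hk : 1 ≤ k) (hm : m + 1 = 2 ^ (k + 3)) :
    ¬ ∀ A B : Matrix (Fin m) (Fin m) (MvPolynomial (Fin (k + 3) × Fin (k + 3)) ℂ),
      (∀ i j, (∃ v, A i j = MvPolynomial.X v) ∨ ∃ c, A i j = MvPolynomial.C c) →
      (∀ i j, (∃ v, B i j = MvPolynomial.X v) ∨ ∃ c, B i j = MvPolynomial.C c) →
      A.det = perPoly (Fin (k + 3)) ℂ → B.det = perPoly (Fin (k + 3)) ℂ →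
      ∃ (P Q : GL (Fin m) ℂ) (γ : GL (Fin (k + 3) × Fin (k + 3)) ℂ),
        γ ∈ permSymmetrySubst ℂ (k + 3) ∧
        (B = (P : Matrix _ _ ℂ).map MvPolynomial.C * Matrix.linSubstEntries γ A * (Q : Matrix _ _ ℂ).map MvPolynomial.C ∨
          B = (P : Matrix _ _ ℂ).map MvPolynomial.C * (Matrix.linSubstEntries γ A).transpose *
            (Q : Matrix _ _ ℂ).map MvPolynomial.C) := by
  intro hU
  -- Grenet's matrix, honest (`e ∅ = 0`, `e univ = last`, `m` odd)
  have hn : (k + 3) ≠ 0 := by omega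
  have hN : 2 ^ (k + 3) = m + 1 := hm.symm
  obtain ⟨e, he0, he1⟩ := Grenet.exists_equiv_empty_univ hn hN
  have hmodd : Odd m := by
    have h8 : 8 ∣ 2 ^ (k + 3) := ⟨2 ^ k, by ring⟩
    rcases h8 with ⟨c, hc⟩
    exact ⟨4 * c - 1, by omega⟩
  have hpar : Odd ((e Finset.univ : ℕ) + (e ∅ : ℕ)) := by
    rw [he0, he1, Fin.val_last, Fin.val_zero, add_zero]; exact hmodd
  set A := Grenet.repr ℂ (k + 3) e with hA
  have hApure : ∀ i j, (∃ v, A i j = X v) ∨ ∃ c, A i j = C c := Grenet.repr_apply_isPure e hpar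
  have hAdet : A.det = perPoly (Fin (k + 3)) ℂ := (Grenet.isAffineDetRepr_repr (k := ℂ) (n := k + 3) hn hN e).2
  -- the purified twist
  obtain ⟨hProw, hPdet, hEQcol, hEQdet⟩ := stub_elementaryOps k
  set P := Matrix.diagonal (fun S : Finset (Fin (k + 3)) =>
            if S = ∅ then (-1 : MvPolynomial (Fin (k + 3) × Fin (k + 3)) ℂ) else 1) *
          Matrix.transvection (∅ : Finset (Fin (k + 3))) {0, 1} (-1) *
          Matrix.transvection ({1} : Finset (Fin (k + 3))) ∅ (-1) *
          Matrix.transvection ({1} : Finset (Fin (k + 3))) {0, 2} 1 *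
          Matrix.transvection ({0} : Finset (Fin (k + 3))) {1, 2} 1 *
          (1 + ∑ l ∈ Finset.filter (fun l : Fin (k + 3) => 2 ≤ l.val) Finset.univ,
            Matrix.single ({l} : Finset (Fin (k + 3))) ({0, 1} : Finset (Fin (k + 3)))
              (1 : MvPolynomial (Fin (k + 3) × Fin (k + 3)) ℂ)) with hPdef
  set EQ := Matrix.transvection ({0} : Finset (Fin (k + 3))) {1, 2} (-(X (1, 0))) *
          Matrix.transvection ({1} : Finset (Fin (k + 3))) {1, 2} (X (0, 0)) *
          Matrix.transvection ({0} : Finset (Fin (k + 3))) {1, 2} (-1) *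
          Matrix.transvection ({0, 2} : Finset (Fin (k + 3))) {1} (-1) *
          Matrix.diagonal (fun T : Finset (Fin (k + 3)) =>
            if T.card = 1 then (-1 : MvPolynomial (Fin (k + 3) × Fin (k + 3)) ℂ) else 1) with hEQdef
  set Kf := P * (1 - Grenet.adj ℂ (k + 3)) * EQ with hKf
  have hcells : ∀ S T : Finset (Fin (k + 3)), S ≠ Finset.univ → T ≠ ∅ →
      ((∃ v, Kf S T = -X v) ∨ ∃ c, Kf S T = C c) ∧
      MvPolynomial.coeff (Finsupp.single ((0 : Fin (k + 3)), (0 : Fin (k + 3))) 1) (Kf S T) =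
        if (S = ∅ ∧ T = {0}) ∨ (S = {1} ∧ T = {0}) ∨ (S = ∅ ∧ T = {1, 2}) then -1 else 0 := by
    intro S T hS hT
    by_cases h : S = ∅ ∨ S = {0} ∨ S = {1}
    · exact stub_cells_special k P EQ hProw hEQcol S T h hT
    · rw [not_or, not_or] at h
      obtain ⟨h1, h2, h3⟩ := h
      obtain ⟨hc, hz⟩ := stub_cells_other k P EQ hProw hEQcol S T hS h1 h2 h3 hT
      refine ⟨hc, ?_⟩
      rw [hz, if_neg]
      rintro (⟨h, -⟩ | ⟨h, -⟩ | ⟨h, -⟩)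
      · exact h1 h
      · exact h3 h
      · exact h1 h
  have hadj : Kf.adjugate ∅ Finset.univ = (-1) ^ k * perPoly (Fin (k + 3)) ℂ :=
    stub_adjugate k P EQ hProw hPdet hEQcol hEQdet
  obtain ⟨hKpure, hKdet, i₁, i₂, j₁, j₂, hi, hj, hKcoeff⟩ := stub_minor k m hm e he0 he1 Kf hcells hadj
  set K := ((-1 : MvPolynomial (Fin (k + 3) × Fin (k + 3)) ℂ) ^ ((e Finset.univ : ℕ) + (e ∅ : ℕ)) •
        ((Kf.submatrix e.symm e.symm).submatrix (Fin.succAbove (e Finset.univ)) (Fin.succAbove (e ∅)))) with hKdef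
  obtain ⟨hprofile, hrank2, hrankperm⟩ := stub_rankToolkit
  -- sign fix: a row swap when `k` is odd
  obtain ⟨B, hBpure, hBdet, hBrank⟩ : ∃ B : Matrix (Fin m) (Fin m) (MvPolynomial (Fin (k + 3) × Fin (k + 3)) ℂ),
      (∀ i j, (∃ v, B i j = X v) ∨ ∃ c, B i j = C c) ∧ B.det = perPoly (Fin (k + 3)) ℂ ∧
      (coeffMat B (0, 0)).rank = 2 := by
    have hrK : (coeffMat K (0, 0)).rank = 2 := by rw [hKcoeff]; exact hrank2 m i₁ i₂ j₁ j₂ hi hj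
    rcases Nat.even_or_odd k with hke | hko
    · refine ⟨K, hKpure, ?_, hrK⟩
      rw [hKdet, hke.neg_one_pow, one_mul]
    · refine ⟨K.submatrix (Equiv.swap i₁ i₂) id, fun i j => hKpure _ _, ?_, ?_⟩
      · rw [Matrix.det_permute, hKdet, Equiv.Perm.sign_swap hi, hko.neg_one_pow]
        simp
      · rw [hrankperm]; exact hrK
  -- compare with Grenet: the rank-2 variable of `B` has no partner in `A`
  obtain ⟨P', Q', γ, hγ, hrel⟩ := hU A B hApure hBpure hAdet hBdet
  obtain ⟨w, hw, hwr⟩ := hprofile (k + 3) m A B P' Q' γ hγ hApure hrel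
  have h2 : (coeffMat A (w (0, 0))).rank = 2 := by rw [← hwr (0, 0)]; exact hBrank
  exact stub_grenetRank k m hk hm e (w (0, 0)) h2

/-- **The line concludes the crux BY NAME — vacuously**: at every level `n ≥ 3` with `Opt n` the
optimal size is `2ⁿ − 1` (Grenet), at which two inequivalent honest projections of `per_n` exist
(`n = 3`: the tree's `not_ProjOptimalUniqueThree`; `n ≥ 4`: `not_uniqAt`), so the antecedent `Uniq n`
of the step is false. -/
theorem UniqStep_of :
    Summit.ValiantsHypothesis.ValiantsHypothesis.Theses.ProjectionStability.UniqStep := by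
  intro n hn hopt huniq hopt'
  exfalso
  have hpdc : detProjectionComplexity (perPoly (Fin n) ℂ) = 2 ^ n - 1 :=
    detProjectionComplexity_perPoly_eq_of_le ℂ (by omega) hopt
  rcases Nat.lt_or_ge n 4 with h3 | h4
  · obtain rfl : n = 3 := by omega
    rw [detProjectionComplexity_perPoly_three] at huniq
    exact Summit.ValiantsHypothesis.ValiantsHypothesis.Theorems.not_ProjOptimalUniqueThree huniq
  · obtain ⟨k, rfl⟩ : ∃ k, n = k + 3 := ⟨n - 3, by omega⟩
    have hk : 1 ≤ k := by omega
    have hm : (2 ^ (k + 3) - 1) + 1 = 2 ^ (k + 3) := by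
      have := Nat.one_le_two_pow (n := k + 3); omega
    rw [hpdc] at huniq
    exact not_uniqAt k (2 ^ (k + 3) - 1) hk hm huniq

end

end Summit.ValiantsHypothesis.ValiantsHypothesis.Cruxes.UniqStep.Vacuous
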